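import Mathlib
import HarnessLib
import Summits.Ventures.LatticeQCDFlow.Exactness.SUNAlcoveCover
import Summits.Ventures.LatticeQCDFlow.Exactness.TorusCubeFundamentalDomain

/-!
# The `N!` Weyl chambers of the `SU(N)` alcove form a fundamental domain of the angle lattice, every `N`: `Leb(S ∩ (−π,π]ⁿ) = Σ_{τ ∈ S_{n+1}} Leb(S ∩ C_τ)` for lattice-invariant `S`

HONEST FRAMING: exact (Metropolis-corrected) sampling algorithms for lattice gauge theory;
figures of merit are autocorrelation/cost numbers at stated couplings and volumes; no
continuum-physics claim.

Venture `LatticeQCDFlow` (cell pub-lqcd), topic `Exactness`; FANOUT row 10 (`eng-equiv`, engine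
`latflow.equiv` `spectral.py`, general `N = n + 1`: free eigen-phases `θ ∈ ℝⁿ`, `x(θ) = (θ, −Σθ)`,
Algorithm 1 moves `x` into the cell `x_{τ0} < ⋯ < x_{τn} < x_{τ0} + 2π` up to a remembered permutation).
NEW WORK of the cell: the every-`N` version of `SU3AlcoveFundamentalDomain.lean`, over this row's
`SUNAlcoveCover.lean` (Algorithm 1 for every `N`) and `TorusCubeFundamentalDomain.lean` (generic
`κ`), and Mathlib (`IsAddFundamentalDomain.mk''`, `Measure.addHaar_submodule`).  Nothing is cited as a
fact; no number; no definition (the chambers enter through the characterising hypothesis `hC`).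
Second brick of the `N ≥ 4` alcove programme (LEANMAP-eng-equiv-gen9 §C″).

## What is typed (`x(θ) = Fin.snoc θ (−Σθ) : Fin (n+1) → ℝ`; chamber
`C τ = {θ | x(θ) ∘ τ strictly increasing ∧ x(θ)(τ last) < x(θ)(τ 0) + 2π}`; lattice `(2πℤ)ⁿ`)

* `sum_phases_sun`, `continuous_phases_sun`, `phases_sun_intMul_add`, `snoc_castSucc_sum_eq`;
* `volume_linearForm_level_eq_zero` (a level set of a nonzero linear form on `ℝⁿ` is Lebesgue-null),
  **`volume_walls_sun_eq_zero`** (degenerate spectra are null in the free phases);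
* `measurableSet_chamber_sun`, **`pairwise_disjoint_chambers_sun`**,
  `exists_intMul_add_mem_chamber_sun`, `intMul_eq_zero_of_mem_chambers_sun`,
  **`isAddFundamentalDomain_chambers_sun`**, **`volume_inter_cube_eq_sum_chambers_sun`** —
  `Leb(S ∩ (−π, π]ⁿ) = Σ_{τ ∈ S_{n+1}} Leb(S ∩ C τ)` for every measurable `(2πℤ)ⁿ`-invariant `S ⊆ ℝⁿ`.

NOT here: the torus `SΔ(n+1)` (the every-`N` version of `SU3TorusChamberDecomposition.lean`); any number.
-/

noncomputable section

namespace Summit.Ventures.LatticeQCDFlow.Exactness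

open MeasureTheory Set Real

variable {n : ℕ}

/-! ## The `n + 1` phases of `n` free phases -/

/-- The phases `(θ, −Σθ)` sum to zero. -/
theorem sum_phases_sun (θ : Fin n → ℝ) : ∑ i, (Fin.snoc θ (-∑ k, θ k) : Fin (n + 1) → ℝ) i = 0 := by
  rw [Fin.sum_univ_castSucc]
  simp only [Fin.snoc_castSucc, Fin.snoc_last, add_neg_cancel]

/-- The phases depend continuously on the free phases. -/
theorem continuous_phases_sun : Continuous fun θ : Fin n → ℝ => (Fin.snoc θ (-∑ k, θ k) : Fin (n + 1) → ℝ) := by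
  refine continuous_pi fun i => ?_
  induction i using Fin.lastCases with
  | last =>
    simp only [Fin.snoc_last]
    exact (continuous_finsetSum _ fun k _ => continuous_apply k).neg
  | cast k =>
    simp only [Fin.snoc_castSucc]
    exact continuous_apply k

/-- An integer vector of free phases extended by minus its sum has sum zero. -/
theorem sum_intVec_sun (m : Fin n → ℤ) : ∑ i, (Fin.snoc m (-∑ k, m k) : Fin (n + 1) → ℤ) i = 0 := by
  rw [Fin.sum_univ_castSucc]
  simp only [Fin.snoc_castSucc, Fin.snoc_last, add_neg_cancel]

/-- A sum-zero vector is its free part extended by minus the sum of the free part. -/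
theorem snoc_castSucc_sum_eq {M : Type*} [AddCommGroup M] (m : Fin (n + 1) → M) (hm : ∑ i, m i = 0) :
    (Fin.snoc (fun k : Fin n => m k.castSucc) (-∑ k : Fin n, m k.castSucc) : Fin (n + 1) → M) = m := by
  funext i
  induction i using Fin.lastCases with
  | last =>
    rw [Fin.snoc_last]
    rw [Fin.sum_univ_castSucc] at hm
    exact neg_eq_of_add_eq_zero_right hm
  | cast k => rw [Fin.snoc_castSucc]

/-- **An integer translation of the free phases shifts the phases by the sum-zero integer vector
`(m, −Σm)` times `2π`.** -/
theorem phases_sun_intMul_add (m : Fin n → ℤ) (θ : Fin n → ℝ) (i : Fin (n + 1)) :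
    (Fin.snoc ((fun k => (m k : ℝ) * (2 * π)) + θ) (-∑ k, ((fun k => (m k : ℝ) * (2 * π)) + θ) k) : Fin (n + 1) → ℝ) i =
      (Fin.snoc θ (-∑ k, θ k) : Fin (n + 1) → ℝ) i + ((Fin.snoc m (-∑ k, m k) : Fin (n + 1) → ℤ) i : ℝ) * (2 * π) := by
  induction i using Fin.lastCases with
  | last =>
    simp only [Fin.snoc_last, Pi.add_apply, Finset.sum_add_distrib]
    push_cast
    rw [← Finset.sum_mul]
    ring
  | cast k =>
    simp only [Fin.snoc_castSucc, Pi.add_apply]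
    ring

/-! ## Null level sets of linear forms and the walls -/

/-- **A level set of a nonzero linear form on `ℝⁿ` is Lebesgue-null** (a translate of the kernel, a
proper submodule). -/
theorem volume_linearForm_level_eq_zero (ℓ : (Fin n → ℝ) →ₗ[ℝ] ℝ) (hℓ : ℓ ≠ 0) (c : ℝ) :
    volume {θ : Fin n → ℝ | ℓ θ = c} = 0 := by
  obtain ⟨v, hv⟩ : ∃ v, ℓ v ≠ 0 := by
    by_contra h
    push Not at h
    exact hℓ (LinearMap.ext fun v => by simpa using h v)
  -- a point on the level set
  set p : Fin n → ℝ := (c / ℓ v) • v with hp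
  have hpℓ : ℓ p = c := by
    rw [hp, map_smul, smul_eq_mul, div_mul_cancel₀ c hv]
  have hset : {θ : Fin n → ℝ | ℓ θ = c} = (fun θ => θ + (-p)) ⁻¹' (LinearMap.ker ℓ : Set (Fin n → ℝ)) := by
    ext θ
    simp only [Set.mem_setOf_eq, Set.mem_preimage, SetLike.mem_coe, LinearMap.mem_ker, map_add, map_neg, hpℓ]
    constructor
    · intro h; rw [h, add_neg_cancel]
    · intro h; linarith
  have hker : (LinearMap.ker ℓ) ≠ ⊤ := by
    intro h
    have : v ∈ LinearMap.ker ℓ := by rw [h]; exact Submodule.mem_top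
    exact hv (LinearMap.mem_ker.mp this)
  rw [hset, measure_preimage_add_right, Measure.addHaar_submodule _ _ hker]

/-- The `i`-th phase as a linear form of the free phases. -/
theorem phases_sun_eq_linearForm (θ : Fin n → ℝ) (i : Fin (n + 1)) :
    (Fin.snoc θ (-∑ k, θ k) : Fin (n + 1) → ℝ) i =
      (Fin.lastCases (-(∑ k : Fin n, LinearMap.proj k)) (fun a => LinearMap.proj a) i :
        (Fin n → ℝ) →ₗ[ℝ] ℝ) θ := by
  induction i using Fin.lastCases with
  | last =>
    rw [Fin.snoc_last, Fin.lastCases_last, LinearMap.neg_apply, LinearMap.sum_apply]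
    rfl
  | cast a =>
    rw [Fin.snoc_castSucc, Fin.lastCases_castSucc]
    rfl

/-- The difference of two distinct phases is a nonzero linear form. -/
theorem phasesDiff_linearForm_ne_zero (i j : Fin (n + 1)) (hij : i ≠ j) :
    (Fin.lastCases (-(∑ k : Fin n, LinearMap.proj k)) (fun a => LinearMap.proj a) i : (Fin n → ℝ) →ₗ[ℝ] ℝ) -
      (Fin.lastCases (-(∑ k : Fin n, LinearMap.proj k)) (fun a => LinearMap.proj a) j : (Fin n → ℝ) →ₗ[ℝ] ℝ) ≠ 0 := by
  intro h
  have happ : ∀ θ : Fin n → ℝ, (Fin.snoc θ (-∑ k, θ k) : Fin (n + 1) → ℝ) i = (Fin.snoc θ (-∑ k, θ k) : Fin (n + 1) → ℝ) j := by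
    intro θ
    have := LinearMap.congr_fun h θ
    rw [LinearMap.sub_apply, LinearMap.zero_apply, sub_eq_zero] at this
    rw [phases_sun_eq_linearForm, phases_sun_eq_linearForm, this]
  induction i using Fin.lastCases with
  | last =>
    induction j using Fin.lastCases with
    | last => exact hij rfl
    | cast b =>
      have h1 := happ (Pi.single b 1)
      simp only [Fin.snoc_last, Fin.snoc_castSucc, Pi.single_eq_same, Finset.sum_pi_single', Finset.mem_univ,
        if_true] at h1
      norm_num at h1
  | cast a =>
    induction j using Fin.lastCases with
    | last =>
      have h1 := happ (Pi.single a 1)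
      simp only [Fin.snoc_last, Fin.snoc_castSucc, Pi.single_eq_same, Finset.sum_pi_single', Finset.mem_univ,
        if_true] at h1
      norm_num at h1
    | cast b =>
      have hab : a ≠ b := fun h => hij (by rw [h])
      have h1 := happ (Pi.single a 1)
      simp only [Fin.snoc_castSucc, Pi.single_eq_same, Pi.single_eq_of_ne (Ne.symm hab)] at h1
      norm_num at h1

/-- **The walls are Lebesgue-null, every `N`**: the free phases for which two of the `n + 1` phases
differ by an integer multiple of `2π` form a null set. -/
theorem volume_walls_sun_eq_zero :
    volume {θ : Fin n → ℝ | ∃ i j : Fin (n + 1), i ≠ j ∧ ∃ k : ℤ,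
      (Fin.snoc θ (-∑ k, θ k) : Fin (n + 1) → ℝ) i - (Fin.snoc θ (-∑ k, θ k) : Fin (n + 1) → ℝ) j = k * (2 * π)} = 0 := by
  have hsub : {θ : Fin n → ℝ | ∃ i j : Fin (n + 1), i ≠ j ∧ ∃ k : ℤ,
      (Fin.snoc θ (-∑ k, θ k) : Fin (n + 1) → ℝ) i - (Fin.snoc θ (-∑ k, θ k) : Fin (n + 1) → ℝ) j = k * (2 * π)} ⊆
      ⋃ i : Fin (n + 1), ⋃ j : Fin (n + 1), ⋃ k : ℤ, {θ : Fin n → ℝ | i ≠ j ∧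
        (Fin.snoc θ (-∑ k, θ k) : Fin (n + 1) → ℝ) i - (Fin.snoc θ (-∑ k, θ k) : Fin (n + 1) → ℝ) j = k * (2 * π)} := by
    rintro θ ⟨i, j, hij, k, hk⟩
    simp only [Set.mem_iUnion, Set.mem_setOf_eq]
    exact ⟨i, j, k, hij, hk⟩
  refine measure_mono_null hsub ?_
  refine measure_iUnion_null fun i => measure_iUnion_null fun j => measure_iUnion_null fun k => ?_
  by_cases hij : i = j
  · have hempty : {θ : Fin n → ℝ | i ≠ j ∧
        (Fin.snoc θ (-∑ k, θ k) : Fin (n + 1) → ℝ) i - (Fin.snoc θ (-∑ k, θ k) : Fin (n + 1) → ℝ) j = k * (2 * π)} = ∅ := by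
      ext θ
      simp [hij]
    rw [hempty, measure_empty]
  · have hset : {θ : Fin n → ℝ | i ≠ j ∧
        (Fin.snoc θ (-∑ k, θ k) : Fin (n + 1) → ℝ) i - (Fin.snoc θ (-∑ k, θ k) : Fin (n + 1) → ℝ) j = k * (2 * π)} =
        {θ : Fin n → ℝ | ((Fin.lastCases (-(∑ k : Fin n, LinearMap.proj k)) (fun a => LinearMap.proj a) i :
            (Fin n → ℝ) →ₗ[ℝ] ℝ) -
          (Fin.lastCases (-(∑ k : Fin n, LinearMap.proj k)) (fun a => LinearMap.proj a) j : (Fin n → ℝ) →ₗ[ℝ] ℝ)) θ =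
            k * (2 * π)} := by
      ext θ
      simp only [Set.mem_setOf_eq, ne_eq, hij, not_false_eq_true, true_and, LinearMap.sub_apply,
        ← phases_sun_eq_linearForm]
    rw [hset]
    exact volume_linearForm_level_eq_zero _ (phasesDiff_linearForm_ne_zero i j hij) _

/-! ## The chambers -/

section Chambers

variable {C : Equiv.Perm (Fin (n + 1)) → Set (Fin n → ℝ)}
  (hC : ∀ τ θ, θ ∈ C τ ↔
    StrictMono ((Fin.snoc θ (-∑ k, θ k) : Fin (n + 1) → ℝ) ∘ τ) ∧
      (Fin.snoc θ (-∑ k, θ k) : Fin (n + 1) → ℝ) (τ (Fin.last n)) <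
        (Fin.snoc θ (-∑ k, θ k) : Fin (n + 1) → ℝ) (τ 0) + 2 * π)

include hC

/-- **Each chamber is measurable.** -/
theorem measurableSet_chamber_sun (τ : Equiv.Perm (Fin (n + 1))) : MeasurableSet (C τ) := by
  have hX : ∀ i : Fin (n + 1), Measurable fun θ : Fin n → ℝ => (Fin.snoc θ (-∑ k, θ k) : Fin (n + 1) → ℝ) i :=
    fun i => (continuous_apply i).measurable.comp continuous_phases_sun.measurable
  have hset : C τ = (⋂ a : Fin n, {θ : Fin n → ℝ | (Fin.snoc θ (-∑ k, θ k) : Fin (n + 1) → ℝ) (τ a.castSucc) <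
      (Fin.snoc θ (-∑ k, θ k) : Fin (n + 1) → ℝ) (τ a.succ)}) ∩
      {θ | (Fin.snoc θ (-∑ k, θ k) : Fin (n + 1) → ℝ) (τ (Fin.last n)) <
        (Fin.snoc θ (-∑ k, θ k) : Fin (n + 1) → ℝ) (τ 0) + 2 * π} := by
    ext θ
    rw [hC, Set.mem_inter_iff, Set.mem_iInter, Fin.strictMono_iff_lt_succ]
    simp only [Function.comp_apply, Set.mem_setOf_eq]
  rw [hset]
  exact (MeasurableSet.iInter fun a => measurableSet_lt (hX _) (hX _)).inter
    (measurableSet_lt (hX _) ((hX _).add_const _))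

/-- **The chambers are pairwise disjoint.** -/
theorem pairwise_disjoint_chambers_sun :
    Pairwise fun τ τ' : Equiv.Perm (Fin (n + 1)) => Disjoint (C τ) (C τ') := by
  intro τ τ' hne
  refine Set.disjoint_left.2 fun θ hθ hθ' => hne ?_
  exact perm_eq_of_strictMono_perm ((hC τ θ).mp hθ).1 ((hC τ' θ).mp hθ').1

/-- **Off the walls, an integer translation lands in a chamber** (Algorithm 1 on the free phases). -/
theorem exists_intMul_add_mem_chamber_sun {θ : Fin n → ℝ}
    (hoff : ∀ i j : Fin (n + 1), i ≠ j → ∀ k : ℤ,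
      (Fin.snoc θ (-∑ k, θ k) : Fin (n + 1) → ℝ) i - (Fin.snoc θ (-∑ k, θ k) : Fin (n + 1) → ℝ) j ≠ k * (2 * π)) :
    ∃ (m : Fin n → ℤ) (τ : Equiv.Perm (Fin (n + 1))), (fun k => (m k : ℝ) * (2 * π)) + θ ∈ C τ := by
  obtain ⟨mm, hmm, τ, hmono, hlast⟩ :=
    exists_latticeShift_sortedChain (by positivity : (0 : ℝ) < 2 * π) (sum_phases_sun θ) hoff
  refine ⟨fun k => mm k.castSucc, τ, (hC τ _).mpr ?_⟩
  -- the shifted phases are `x(θ) + 2π mm`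
  have hX : (Fin.snoc ((fun k => ((fun k : Fin n => mm k.castSucc) k : ℝ) * (2 * π)) + θ)
      (-∑ k, ((fun k => ((fun k : Fin n => mm k.castSucc) k : ℝ) * (2 * π)) + θ) k) : Fin (n + 1) → ℝ) =
      fun i => (Fin.snoc θ (-∑ k, θ k) : Fin (n + 1) → ℝ) i + (mm i : ℝ) * (2 * π) := by
    funext i
    rw [phases_sun_intMul_add, snoc_castSucc_sum_eq mm hmm]
  rw [hX]
  exact ⟨hmono, hlast⟩

/-- **Two points of the chambers differing by an integer translation are equal.** -/
theorem intMul_eq_zero_of_mem_chambers_sun {θ : Fin n → ℝ} {m : Fin n → ℤ} {τ τ' : Equiv.Perm (Fin (n + 1))}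
    (hθ : θ ∈ C τ) (hθ' : (fun k => (m k : ℝ) * (2 * π)) + θ ∈ C τ') : m = 0 := by
  obtain ⟨hmono, hlast⟩ := (hC τ θ).mp hθ
  obtain ⟨hmono', hlast'⟩ := (hC τ' _).mp hθ'
  have hy := abs_sub_lt_of_sortedChain hmono hlast
  have hX : (Fin.snoc ((fun k => (m k : ℝ) * (2 * π)) + θ) (-∑ k, ((fun k => (m k : ℝ) * (2 * π)) + θ) k) :
      Fin (n + 1) → ℝ) =
      fun i => (Fin.snoc θ (-∑ k, θ k) : Fin (n + 1) → ℝ) i + ((Fin.snoc m (-∑ k, m k) : Fin (n + 1) → ℤ) i : ℝ) * (2 * π) :=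
    funext (phases_sun_intMul_add m θ)
  rw [hX] at hmono' hlast'
  have hy' := abs_sub_lt_of_sortedChain hmono' hlast'
  have hm := latticeShift_eq_zero_of_pairwise_fin (by positivity : (0 : ℝ) < 2 * π) (sum_intVec_sun m) hy hy'
  funext k
  simpa using congr_fun hm k.castSucc

/-- **The `(n+1)!` chambers form a fundamental domain of the angle lattice `(2πℤ)ⁿ` acting on `ℝⁿ` by
translation** (Lebesgue measure), every `N = n + 1`. -/
theorem isAddFundamentalDomain_chambers_sun :
    IsAddFundamentalDomain (AddSubgroup.pi Set.univ fun _ : Fin n => AddSubgroup.zmultiples (2 * π))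
      (⋃ τ, C τ) (volume : Measure (Fin n → ℝ)) := by
  refine IsAddFundamentalDomain.mk'' ?_ ?_ ?_ ?_
  · exact (MeasurableSet.iUnion (measurableSet_chamber_sun hC)).nullMeasurableSet
  · rw [ae_iff]
    refine measure_mono_null (fun θ hθ => ?_) volume_walls_sun_eq_zero
    simp only [Set.mem_setOf_eq] at hθ ⊢
    by_contra hoff
    push Not at hoff
    apply hθ
    obtain ⟨m, τ, hmem⟩ := exists_intMul_add_mem_chamber_sun hC (θ := θ) (fun i j hij k hk => hoff i j hij k hk)
    exact ⟨⟨fun k => (m k : ℝ) * (2 * π), intMul_mem_latticePi _ m⟩, Set.mem_iUnion.2 ⟨τ, hmem⟩⟩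
  · intro g hg
    refine (Set.disjoint_left.2 fun x hx hx' => hg ?_).aedisjoint
    obtain ⟨d, hd, rfl⟩ := Set.mem_vadd_set.mp hx
    obtain ⟨τ, hdτ⟩ := Set.mem_iUnion.1 hd
    obtain ⟨τ', hxτ'⟩ := Set.mem_iUnion.1 hx'
    obtain ⟨m, hm⟩ := (mem_latticePi_iff_exists (g : Fin n → ℝ)).mp g.2
    rw [latticePi_vadd_eq, hm] at hxτ'
    have hm0 := intMul_eq_zero_of_mem_chambers_sun hC hdτ hxτ'
    apply Subtype.ext
    rw [hm, hm0]
    funext k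
    simp
  · intro g
    exact (measurePreserving_add_left volume (g : Fin n → ℝ)).quasiMeasurePreserving

/-- **The chamber decomposition of the angle cube, every `N`**: for every measurable `S ⊆ ℝⁿ`
invariant under the integer translations `θ ↦ 2πm + θ`,
`Leb(S ∩ (−π, π]ⁿ) = Σ_{τ ∈ S_{n+1}} Leb(S ∩ C τ)`. -/
theorem volume_inter_cube_eq_sum_chambers_sun {S : Set (Fin n → ℝ)} (hS : MeasurableSet S)
    (hinv : ∀ m : Fin n → ℤ, (fun θ : Fin n → ℝ => (fun k => (m k : ℝ) * (2 * π)) + θ) ⁻¹' S = S) :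
    volume (S ∩ Set.pi Set.univ fun _ : Fin n => Ioc (-π) π) = ∑ τ : Equiv.Perm (Fin (n + 1)), volume (S ∩ C τ) := by
  have h := volume_inter_cube_eq_sum_of_isAddFundamentalDomain (by positivity : (0 : ℝ) < 2 * π) (-π)
    (measurableSet_chamber_sun hC) (pairwise_disjoint_chambers_sun hC)
    (isAddFundamentalDomain_chambers_sun hC) hS hinv
  rwa [show -π + 2 * π = π by ring] at h

end Chambers

end Summit.Ventures.LatticeQCDFlow.Exactness
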